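import Literature.AlgebraicGeometry.Aoki1983.SemiStandard
import HarnessLib

/-!
# Fermat cycles — the divisors `q ∣ 2ᵃ3ᵇ5ᶜ7ᵈ` with `μ′(q) = 1` (kernel certificate of the list used in the cell's `CANCEL-35` §3)

HONEST FRAMING: explicit algebraic cycles for specific Hodge classes on Fermat/Delsarte varieties;
residual open instances listed; no claim on general Hodge.

Aoki's structure theorem ([Aoki1983] Thm D; [Aoki2000FermatTypeRemarks] Thm 2.1) makes `B_m` a `ℤ[G]`-module
generated by the standard elements and the images `(m/q)ξ_q` of the semi-standard elements for the divisors
`q > 1` of `m` with `μ′(q) = 1`, `μ′` being Aoki's modified Möbius function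
(`Literature.AlgebraicGeometry.Aoki1983.muPrime`). Aoki's proof of [Aoki2000FermatTypeRemarks] Thm 0.1 (p. 185)
lists these `q` for `m = 2ᵃ3ᵇ5ᶜ7ᵈ` with `cd = 0` as `12, 15, 20, 21, 28`. The cell's reduction of all degrees
`m = 2ᵃ3ᵇ5ᶜ7ᵈ`, `420 ∤ m`, to the single class `ξ₃₅` (file `run/shared/lean/pub/pub-hfermat/pub-hfermat-search-2/
CANCEL-35.md` §3; literature audit `…/lit/AUDIT-LIT-UNIRULED70-CANCEL35.md`) uses the complete list for `cd ≠ 0`: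
`{12, 15, 20, 21, 28, 35, 420}`. This file is the kernel certificate of that list (OUR bookkeeping, hence under
`Summits/`): if every prime factor of `q` lies in `{2, 3, 5, 7}` and `μ′(q) = 1`, then
`q ∈ {1, 12, 15, 20, 21, 28, 35, 420}`, and conversely `μ′ = 1` at each listed `q > 1`.
-/

open Nat Finset ArithmeticFunction
open Literature.AlgebraicGeometry.Aoki1983

namespace Summit.HodgeConjecture.FermatCycles.MuPrimeDivisors

/-- For a squarefree `n`, `Ω n` is the number of distinct prime factors. [folklore] -/
theorem cardFactors_eq_card_primeFactors {n : ℕ} (hn : Squarefree n) :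
    ArithmeticFunction.cardFactors n = n.primeFactors.card := by
  rw [cardFactors_apply, ← Nat.toFinset_factors,
    List.toFinset_card_of_nodup ((Nat.squarefree_iff_nodup_primeFactorsList hn.ne_zero).1 hn)]

/-- `μ(n) = 1` forces `n` squarefree with an even number of prime factors. [folklore] -/
theorem squarefree_and_even_of_moebius_eq_one {n : ℕ} (h : ArithmeticFunction.moebius n = 1) :
    Squarefree n ∧ Even n.primeFactors.card := by
  have hsq : Squarefree n := moebius_ne_zero_iff_squarefree.1 (by rw [h]; decide)
  refine ⟨hsq, ?_⟩
  rw [moebius_apply_of_squarefree hsq, cardFactors_eq_card_primeFactors hsq] at h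
  exact (neg_one_pow_eq_one_iff_even (by decide)).1 h

/-- `μ(n) = −1` forces `n` squarefree with an odd number of prime factors. [folklore] -/
theorem squarefree_and_odd_of_moebius_eq_neg_one {n : ℕ} (h : ArithmeticFunction.moebius n = -1) :
    Squarefree n ∧ Odd n.primeFactors.card := by
  have hsq : Squarefree n := moebius_ne_zero_iff_squarefree.1 (by rw [h]; decide)
  refine ⟨hsq, ?_⟩
  rw [moebius_apply_of_squarefree hsq, cardFactors_eq_card_primeFactors hsq] at h
  rcases Nat.even_or_odd n.primeFactors.card with he | ho
  · rw [he.neg_one_pow] at h; exact absurd h (by decide)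
  · exact ho

/-- The even-size subsets of `{3, 5, 7}` have products `1, 15, 21, 35`; stated over all subsets of `{2,3,5,7}`
avoiding `2` (kernel decision). [folklore] -/
theorem prod_mem_of_even : ∀ S ∈ ({2, 3, 5, 7} : Finset ℕ).powerset, 2 ∉ S → Even S.card →
    (∏ p ∈ S, p) ∈ ({1, 15, 21, 35} : Finset ℕ) := by
  decide

/-- The odd-size subsets of `{3, 5, 7}` have products `3, 5, 7, 105` (kernel decision). [folklore] -/
theorem prod_mem_of_odd : ∀ S ∈ ({2, 3, 5, 7} : Finset ℕ).powerset, 2 ∉ S → Odd S.card →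
    (∏ p ∈ S, p) ∈ ({3, 5, 7, 105} : Finset ℕ) := by
  decide

/-- **The `μ′ = 1` divisors supported on `{2,3,5,7}`.** If every prime factor of `q` lies in `{2, 3, 5, 7}` and
Aoki's `μ′(q) = 1`, then `q ∈ {1, 12, 15, 20, 21, 28, 35, 420}`. (So for `m = 2ᵃ3ᵇ5ᶜ7ᵈ` the semi-standard
generators of Aoki's Thm D are indexed by `q ∈ {12, 15, 20, 21, 28, 35, 420} ∩ divisors(m)`.)
[cite: Aoki1983, (3.3) p. 32 and Thm D p. 38] [cite: Aoki2000FermatTypeRemarks, p. 181 (μ′) and p. 185 (proof of Thm 0.1: q = 12, 15, 20, 21, 28 when cd = 0)] -/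
theorem mem_list_of_muPrime_eq_one {q : ℕ} (hP : q.primeFactors ⊆ ({2, 3, 5, 7} : Finset ℕ))
    (h : muPrime q = 1) : q ∈ ({1, 12, 15, 20, 21, 28, 35, 420} : Finset ℕ) := by
  unfold muPrime at h
  split_ifs at h with h2 h8
  · -- `q` odd: `μ(q) = 1`
    obtain ⟨hsq, hev⟩ := squarefree_and_even_of_moebius_eq_one h
    have h2n : 2 ∉ q.primeFactors := by
      intro hm; have := Nat.dvd_of_mem_primeFactors hm; omega
    have hq : ∏ p ∈ q.primeFactors, p = q := Nat.prod_primeFactors_of_squarefree hsq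
    have := prod_mem_of_even q.primeFactors (Finset.mem_powerset.2 hP) h2n hev
    rw [hq] at this
    simp only [Finset.mem_insert, Finset.mem_singleton] at this ⊢
    omega
  · -- `q ≡ 4 (mod 8)`: `μ(q/4) = −1`
    have h' : ArithmeticFunction.moebius (q / 4) = -1 := by omega
    obtain ⟨hsq, hod⟩ := squarefree_and_odd_of_moebius_eq_neg_one h'
    have hq4 : q = 4 * (q / 4) := by omega
    have hsub : (q / 4).primeFactors ⊆ ({2, 3, 5, 7} : Finset ℕ) :=
      (Nat.primeFactors_mono ⟨4, by omega⟩ (by omega)).trans hP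
    have h2n : 2 ∉ (q / 4).primeFactors := by
      intro hm; have := Nat.dvd_of_mem_primeFactors hm; omega
    have hq : ∏ p ∈ (q / 4).primeFactors, p = q / 4 := Nat.prod_primeFactors_of_squarefree hsq
    have := prod_mem_of_odd (q / 4).primeFactors (Finset.mem_powerset.2 hsub) h2n hod
    rw [hq] at this
    simp only [Finset.mem_insert, Finset.mem_singleton] at this ⊢
    omega
  · exact absurd h (by decide)

/-- The same list for a divisor `q > 1` of a number `m = 2ᵃ3ᵇ5ᶜ7ᵈ` (the form in which Aoki's Thm D uses it).
[cite: Aoki2000FermatTypeRemarks, Thm 2.1 p. 181 and p. 185] -/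
theorem mem_list_of_dvd_of_muPrime_eq_one {q a b c d : ℕ} (hq : q ∣ 2 ^ a * 3 ^ b * 5 ^ c * 7 ^ d)
    (h1 : 1 < q) (h : muPrime q = 1) : q ∈ ({12, 15, 20, 21, 28, 35, 420} : Finset ℕ) := by
  have hm0 : 2 ^ a * 3 ^ b * 5 ^ c * 7 ^ d ≠ 0 := by positivity
  have hP : q.primeFactors ⊆ ({2, 3, 5, 7} : Finset ℕ) := by
    intro p hp
    have hp' := Nat.primeFactors_mono hq hm0 hp
    have hpp : p.Prime := Nat.prime_of_mem_primeFactors hp'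
    have hdvd : p ∣ 2 ^ a * 3 ^ b * 5 ^ c * 7 ^ d := Nat.dvd_of_mem_primeFactors hp'
    simp only [Finset.mem_insert, Finset.mem_singleton]
    rcases (Nat.Prime.dvd_mul hpp).1 hdvd with h | h
    · rcases (Nat.Prime.dvd_mul hpp).1 h with h | h
      · rcases (Nat.Prime.dvd_mul hpp).1 h with h | h
        · exact Or.inl ((Nat.prime_dvd_prime_iff_eq hpp Nat.prime_two).1 (hpp.dvd_of_dvd_pow h))
        · exact Or.inr (Or.inl ((Nat.prime_dvd_prime_iff_eq hpp Nat.prime_three).1 (hpp.dvd_of_dvd_pow h)))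
      · exact Or.inr (Or.inr (Or.inl ((Nat.prime_dvd_prime_iff_eq hpp Nat.prime_five).1 (hpp.dvd_of_dvd_pow h))))
    · exact Or.inr (Or.inr (Or.inr ((Nat.prime_dvd_prime_iff_eq hpp (by decide : Nat.Prime 7)).1
        (hpp.dvd_of_dvd_pow h))))
  have := mem_list_of_muPrime_eq_one hP h
  simp only [Finset.mem_insert, Finset.mem_singleton] at this ⊢
  omega

/-! ### The converse values -/

/-- `7` is prime. [folklore] -/
private theorem prime7 : Nat.Prime 7 := by decide

/-- `μ′ = 1` at `12, 15, 20, 21, 28, 35` and `420` (so the list is exact). [cite: Aoki2000FermatTypeRemarks, p. 185 (12, 15, 20, 21, 28)] [cite: Aoki1983, (3.3)] -/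
theorem muPrime_list_values : muPrime 12 = 1 ∧ muPrime 15 = 1 ∧ muPrime 20 = 1 ∧ muPrime 21 = 1 ∧
    muPrime 28 = 1 ∧ muPrime 35 = 1 ∧ muPrime 420 = 1 := by
  have hM := ArithmeticFunction.isMultiplicative_moebius
  refine ⟨muPrime_values.2.2.2, ?_, ?_, ?_, ?_, muPrime_thirtyFive, ?_⟩
  · have e : (15 : ℕ) = 3 * 5 := by norm_num
    simp [muPrime, e, hM.map_mul_of_coprime (show Nat.Coprime 3 5 by norm_num),
      moebius_apply_prime Nat.prime_three, moebius_apply_prime Nat.prime_five]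
  · have e : (20 : ℕ) / 4 = 5 := by norm_num
    simp [muPrime, e, moebius_apply_prime Nat.prime_five]
  · have e : (21 : ℕ) = 3 * 7 := by norm_num
    simp [muPrime, e, hM.map_mul_of_coprime (show Nat.Coprime 3 7 by norm_num),
      moebius_apply_prime Nat.prime_three, moebius_apply_prime prime7]
  · have e : (28 : ℕ) / 4 = 7 := by norm_num
    simp [muPrime, e, moebius_apply_prime prime7]
  · have e : (420 : ℕ) / 4 = 3 * 5 * 7 := by norm_num
    simp [muPrime, e, hM.map_mul_of_coprime (show Nat.Coprime (3 * 5) 7 by norm_num),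
      hM.map_mul_of_coprime (show Nat.Coprime 3 5 by norm_num),
      moebius_apply_prime Nat.prime_three, moebius_apply_prime Nat.prime_five, moebius_apply_prime prime7]

/-- KERNEL TABLE (`decide +kernel`; LIT g14): the `q` with `2 ≤ q ≤ 300` and `μ′(q) = 1` — the index set of Aoki's semi-standard
generators `ξ_q` [cite: Aoki1983, Thm D] [cite: Aoki2000FermatTypeRemarks, Thm 2.1] — are the 73 listed (products of two distinct
elements of `P = {4} ∪ {odd primes}`; the first product of four, `4·3·5·7 = 420`, is out of range). The five `12, 15, 20, 21, 28` are
the ones whose `ξ_q` is algebraic in print [cite: Aoki2000FermatTypeRemarks, proof of Thm 0.1 p. 185]; cf. `OpenInPrint.open_iff_semistandard_le_300`. -/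
theorem muPrime_eq_one_table_le_300 :
    (Finset.Icc 2 300).filter (fun q ↦ muPrime q = 1) =
      {12, 15, 20, 21, 28, 33, 35, 39, 44, 51, 52, 55, 57, 65, 68, 69, 76, 77, 85, 87, 91, 92, 93, 95, 111, 115, 116, 119,
        123, 124, 129, 133, 141, 143, 145, 148, 155, 159, 161, 164, 172, 177, 183, 185, 187, 188, 201, 203, 205, 209, 212,
        213, 215, 217, 219, 221, 235, 236, 237, 244, 247, 249, 253, 259, 265, 267, 268, 284, 287, 291, 292, 295, 299} := by
  decide +kernel

/-- In particular exactly 73 levels `q ≤ 300` carry a semi-standard generator, 68 of them beyond the printed five. [cite: Aoki1983, Thm D] -/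
theorem card_muPrime_eq_one_le_300 :
    ((Finset.Icc 2 300).filter (fun q ↦ muPrime q = 1)).card = 73 := by
  decide +kernel

end Summit.HodgeConjecture.FermatCycles.MuPrimeDivisors
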